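import Summits.BirchSwinnertonDyer.BirchSwinnertonDyer.Theorems.AlignedTransportAtTwoMainConjectureTransportAlignedAtTwoAddTwistTameLevel
import Summits.BirchSwinnertonDyer.BirchSwinnertonDyer.Theorems.AlignedTransportAtTwoMainConjectureTransportAlignedAtTwoAddTwistCongruence
import HarnessLib

/-!
# Route `AlignedTransportAtTwo`, crux C1 `MainConjectureTransportAlignedAtTwo` (stmt-BirchSwinnertonDyer-22296), line `birth` —
# the BOTH-ADDITIVE twist sub-cell, part 2d (COMPOSITE-LEVEL CONGRUENCE): `‖Σ_{(b|m'ℓ)=ε} μ_{f,α,m'ℓ}‖₂ ≤ 2` and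
# `L₂(f,α,χ_{m'ℓ}) ≡ u·L₂(f,α)·∏_{q∣m'}𝒫_q (mod 2Λ)` at the tame level `m'·ℓ`, `ℓ² ∣ N`, `a_ℓ = 0`, `gcd(m', 2N) = 1`

HONEST FRAMING (cell `bsd-f1-sign2`, WIDTH-5 attach seat `bsd-line-att-p4` g9, under the lead `bsd-line-att-p1`). BSD is NOT
proved; C1 is NOT closed. THEOREMS ONLY; nothing asserted; `--supports stmt-BirchSwinnertonDyer-22296 --as helper`. Sequel of
`…AddTwistTameLevel` (tame fractions and Chinese-remainder character sums at level `m'ℓ`) and `…AddTwistCongruence` (the prime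
level). PURPOSE: the leg `u = ℓ·q` (auxiliary good prime `q`) of the lead's walk engine for a both-additive prime `ℓ ≡ 3 (mod 4)`.

* §3 `norm_sum_filter_msdMeasureTame_level_le_two` — the `½ℤ₂`-valuedness of the Jacobi-character halves of the tame measure at
  level `m'ℓ` (unit classes).
* §4 `exists_iwasawa_pair_map_toZMod_eq_two_level` — `L₂(f,α,χ_{m'ℓ}), L₂(f,α,𝟙_{m'ℓ}) ∈ Λ` with equal reductions mod `2`.
* §5 **`exists_iwasawa_padicLFunctionTame_congr_two_level`** — `L₂(f,α,χ_{m'ℓ}) ≡ v·L₂(f,α)·∏_{v∈S₀}𝒫_v (mod 2Λ)` with `S₀` the places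
  of `m'` (good or multiplicative): the both-additive prime contributes NO Euler factor (level change at `ℓ ∣ N` with `U_ℓ f = 0`).
  This is the `hcong` input of the lead's analytic-Kida/line-law assembly for the leg `u = ℓ·m'`.

References: [MazurTateTeitelbaum1986Invent] §I.8, §I.10–§I.13; [Matsuno2000] Lemmas 3.2–3.3, Thm. 3.1 (pp. 86–88).
-/

set_option autoImplicit false
set_option linter.dupNamespace false

noncomputable section

open scoped Classical MatrixGroups ModularForm NumberTheorySymbols

open CongruenceSubgroup Filter Topology PowerSeries
open Literature.NumberTheory.EllipticCurves Literature.NumberTheory.EllipticCurves.ModularForms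
open Literature.NumberTheory.EllipticCurves.GreenbergVatsal2000
open Summit.BirchSwinnertonDyer.BirchSwinnertonDyer.Theorems.AlignedTransportAtTwoAddTwistCusp
open Summit.BirchSwinnertonDyer.BirchSwinnertonDyer.Theorems.AlignedTransportAtTwoAddTwistHalfSums
open Summit.BirchSwinnertonDyer.BirchSwinnertonDyer.Theorems.AlignedTransportAtTwoAddTwistTame
open Summit.BirchSwinnertonDyer.BirchSwinnertonDyer.Theorems.AlignedTransportAtTwoAddTwistTameLevel
open Summit.BirchSwinnertonDyer.BirchSwinnertonDyer.Theorems.AlignedTransportAtTwoAddTwistCongruence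

namespace Summit.BirchSwinnertonDyer.BirchSwinnertonDyer.Theorems.AlignedTransportAtTwoAddTwistCongruenceLevel

/-! ## §3 The bound `‖Σ_{(b|m'ℓ)=ε} μ_{f,α,m'ℓ}‖₂ ≤ 2` -/

section Measure

variable {N : ℕ} [NeZero N] (f : CuspForm (Gamma0 N) 2) {ℓ m' : ℕ} [Fact ℓ.Prime] [NeZero m'] [NeZero (m' * ℓ)]
  {W : WeierstrassCurve ℚ} [W.IsElliptic] [W.IsGloballyMinimal]

omit [NeZero N] [NeZero m'] [NeZero (m' * ℓ)] in
/-- `2` is a unit mod the odd prime `ℓ`; private helper. [folklore] -/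
private theorem two_ne_zero_zmod' (hℓ2 : ℓ.Coprime 2) : (2 : ZMod ℓ) ≠ 0 := by
  have hℓ : ℓ.Prime := Fact.out
  have h : ((2 : ℕ) : ZMod ℓ) ≠ 0 := by
    rw [Ne, ZMod.natCast_eq_zero_iff]
    intro h
    have h2 : ℓ = 2 := le_antisymm (Nat.le_of_dvd two_pos h) hℓ.two_le
    rw [h2] at hℓ2
    norm_num at hℓ2
  exact_mod_cast h

omit [NeZero N] [Fact ℓ.Prime] [NeZero m'] in
/-- A class with `(b | m'ℓ) = ±1` is a unit mod `m'ℓ`; private helper. [folklore] -/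
private theorem isUnit_of_jacobiSym_eq {b : ZMod (m' * ℓ)} {ε : ℤ} (hε : ε = 1 ∨ ε = -1)
    (hb : J((b.val : ℤ) | m' * ℓ) = ε) : IsUnit b := by
  have hne : J((b.val : ℤ) | m' * ℓ) ≠ 0 := by rcases hε with h | h <;> rw [hb, h] <;> norm_num
  have hcop : (b.val : ℤ).gcd (m' * ℓ : ℕ) = 1 := by
    by_contra h
    exact hne (jacobiSym.eq_zero_iff_not_coprime.mpr h)
  rw [Int.gcd_natCast_natCast] at hcop
  have h := (ZMod.isUnit_iff_coprime b.val (m' * ℓ)).mpr hcop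
  rwa [ZMod.natCast_zmod_val] at h

/-- **`‖Σ_{(b|m'ℓ)=ε} [x_b]⁺ + …‖`: a character sum of tame symbols at level `m'ℓ`, each in the class `[u·b̄/ℓ]`, has `2`-adic norm `≤ 2`**
(`u` a unit of `ℤ/ℓ`; §1–§2). [cite: MazurTateTeitelbaum1986Invent, §I.8 and §I.10] -/
theorem norm_ratCast_sum_filter_jacobi_le_two (hf : IsNewform0 f) (hreal : ∀ n, (cuspCoeff f n).im = 0)
    (hrat : ∀ r : ℚ, (ratPlusSymbol f r : ℝ) = normalizedPlusSymbol f r)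
    (hℓN : ℓ ^ 2 ∣ N) (haℓ : cuspCoeff f ℓ = 0) {q : ℕ} [Fact q.Prime] (hqN : ¬ q ∣ N) {aq : ℤ}
    (haq : cuspCoeff f q = aq) (hodd : ¬ (2 : ℤ) ∣ aq - q - 1) (hcop : m'.Coprime ℓ) {u : ZMod ℓ} (hu : u ≠ 0)
    {ε : ℤ} (hε : ε = 1 ∨ ε = -1) {X : ZMod (m' * ℓ) → ℚ}
    (hX : ∀ b ∈ Finset.univ.filter (fun b : ZMod (m' * ℓ) ↦ J((b.val : ℤ) | m' * ℓ) = ε), ∃ j : ℤ,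
      X b = ratPlusSymbol f (((u * ((b.val : ℕ) : ZMod ℓ)).val : ℚ) / ℓ) + (j : ℚ) / 2) :
    ‖(((∑ b ∈ Finset.univ.filter (fun b : ZMod (m' * ℓ) ↦ J((b.val : ℤ) | m' * ℓ) = ε), X b : ℚ)) : ℚ_[2])‖ ≤ 2 := by
  obtain ⟨j, hj⟩ := exists_sum_eq_sum_add_div_two _ hX
  obtain ⟨n₁, k, hn₁, hk⟩ :=
    exists_sum_filter_jacobi_level_ratPlusSymbol_eq f hf hreal hrat hℓN haℓ hqN haq hodd hcop hu hε
  refine norm_ratCast_le_two_of_eq_div_two_mul (n₁ := n₁) (j := k + j * n₁) hn₁ ?_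
  have hn₁Q : (n₁ : ℚ) ≠ 0 := by exact_mod_cast (show n₁ ≠ 0 by rintro rfl; exact hn₁ (dvd_zero 2))
  rw [hj, hk]
  push_cast
  field_simp

/-- **`‖Σ_{(b|m'ℓ)=ε} μ_{f,α,m'ℓ}((a + 2ⁿℤ₂) × {b})‖₂ ≤ 2`** for the newform `f` (level `N`, `ℓ² ∣ N`, `a_ℓ(f) = 0`, `gcd(m', 2N) = 1`)
of `E = W` good ordinary at `2` (`α` the unit root), `ε = ±1`, `a` a UNIT mod `2ⁿ`, given one odd prime `q ∤ N` with `a_q − q − 1` odd.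
The composite-level twin of `…AddTwistTame.norm_sum_filter_msdMeasureTame_le_two`. [cite: MazurTateTeitelbaum1986Invent, §I.10 (10.1)]
[cite: Matsuno2000, Lemma 3.2 (p. 87)] -/
theorem norm_sum_filter_msdMeasureTame_level_le_two (hord : IsOrdinaryAt W 2) (hf : IsNewformOf W f)
    (hℓN : ℓ ^ 2 ∣ N) (haℓ : cuspCoeff f ℓ = 0) {q : ℕ} [Fact q.Prime] (hqN : ¬ q ∣ N) {aq : ℤ}
    (haq : cuspCoeff f q = aq) (hodd : ¬ (2 : ℤ) ∣ aq - q - 1) (hm'N : m'.Coprime N) (hm'2 : m'.Coprime 2)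
    {ε : ℤ} (hε : ε = 1 ∨ ε = -1) (n : ℕ) {a : ZMod (2 ^ n)} (ha : IsUnit a) :
    ‖∑ b ∈ Finset.univ.filter (fun b : ZMod (m' * ℓ) ↦ J((b.val : ℤ) | m' * ℓ) = ε),
        msdMeasureTame f (m' * ℓ) (unitRoot W 2 : ℚ_[2]) n a b‖ ≤ 2 := by
  have hℓ : ℓ.Prime := Fact.out
  have h2N : ¬ 2 ∣ N := not_dvd_level_of_isNewformOf hf hord.1
  have hℓN' : ℓ ∣ N := (dvd_pow_self ℓ two_ne_zero).trans hℓN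
  have hℓ2 : ℓ.Coprime 2 := (Nat.coprime_primes hℓ Nat.prime_two).mpr (by rintro rfl; exact h2N hℓN')
  have hM2 : (m' * ℓ).Coprime 2 := Nat.Coprime.mul_left hm'2 hℓ2
  have hcop : m'.Coprime ℓ := Nat.Coprime.coprime_dvd_right hℓN' hm'N
  have hreal : ∀ n, (cuspCoeff f n).im = 0 := cuspCoeff_im_eq_zero_of_coeffField_eq_bot hf.coeffField_eq_bot
  have hrat := ratCast_ratPlusSymbol_of_maninDrinfeld
    (exists_nsmul_modularSymbol_mem_periodLattice_of_isNewform0 hf.1 hf.coeffField_eq_bot)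
  obtain ⟨-, hαu, -⟩ := unitRoot_coe_spec (W := W) hord
  set α : ℚ_[2] := (unitRoot W 2 : ℚ_[2]) with hα
  have hαi : ∀ k : ℕ, ‖α⁻¹ ^ k‖ ≤ 1 := fun k ↦ by rw [norm_pow, norm_inv, hαu, inv_one, one_pow]
  have h20 : (2 : ZMod ℓ) ≠ 0 := two_ne_zero_zmod' hℓ2
  have hm'0 : (m' : ZMod ℓ) ≠ 0 := by
    rw [Ne, ZMod.natCast_eq_zero_iff]
    intro h
    have := Nat.Coprime.eq_one_of_dvd (Nat.coprime_comm.mp hcop) h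
    exact hℓ.one_lt.ne' this
  set B := Finset.univ.filter (fun b : ZMod (m' * ℓ) ↦ J((b.val : ℤ) | m' * ℓ) = ε) with hB
  have hunit : ∀ b ∈ B, IsUnit b := fun b hb ↦ by
    rw [hB, Finset.mem_filter] at hb
    exact isUnit_of_jacobiSym_eq hε hb.2
  have hsplit : ∑ b ∈ B, msdMeasureTame f (m' * ℓ) α n a b =
      α⁻¹ ^ n * (((∑ b ∈ B, ratPlusSymbol f (tameFraction 2 (m' * ℓ) n a b) : ℚ)) : ℚ_[2]) -
        α⁻¹ ^ (n + 1) *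
          (((∑ b ∈ B, ratPlusSymbol f (((2 : ℕ) : ℚ) * tameFraction 2 (m' * ℓ) n a b) : ℚ)) : ℚ_[2]) := by
    simp only [msdMeasureTame]
    rw [Finset.sum_sub_distrib, Rat.cast_sum, Rat.cast_sum, Finset.mul_sum, Finset.mul_sum]
  rw [hsplit]
  have hA : ‖(((∑ b ∈ B, ratPlusSymbol f (tameFraction 2 (m' * ℓ) n a b) : ℚ)) : ℚ_[2])‖ ≤ 2 :=
    norm_ratCast_sum_filter_jacobi_le_two f hf.1 hreal hrat hℓN haℓ hqN haq hodd hcop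
      (mul_ne_zero (pow_ne_zero _ h20) hm'0) hε fun b hb ↦
        exists_ratPlusSymbol_tameFraction_level_eq f hreal hrat hℓN h2N hm'N hM2 n ha (hunit b hb)
  have hB' : ‖(((∑ b ∈ B, ratPlusSymbol f (((2 : ℕ) : ℚ) * tameFraction 2 (m' * ℓ) n a b) : ℚ)) : ℚ_[2])‖ ≤ 2 := by
    cases n with
    | zero =>
      exact norm_ratCast_sum_filter_jacobi_le_two f hf.1 hreal hrat hℓN haℓ hqN haq hodd hcop (mul_ne_zero h20 hm'0) hε
        fun b hb ↦ exists_ratPlusSymbol_two_mul_tameFraction_level_zero_eq f hreal hrat hℓN h2N hm'N hM2 a (hunit b hb)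
    | succ n =>
      exact norm_ratCast_sum_filter_jacobi_le_two f hf.1 hreal hrat hℓN haℓ hqN haq hodd hcop
        (mul_ne_zero (pow_ne_zero _ h20) hm'0) hε
        fun b hb ↦ exists_ratPlusSymbol_two_mul_tameFraction_level_succ_eq f hreal hrat hℓN h2N hm'N hM2 n ha (hunit b hb)
  have h1 : ‖α⁻¹ ^ n * (((∑ b ∈ B, ratPlusSymbol f (tameFraction 2 (m' * ℓ) n a b) : ℚ)) : ℚ_[2])‖ ≤ 2 := by
    rw [norm_mul]
    calc _ ≤ (1 : ℝ) * 2 := mul_le_mul (hαi n) hA (norm_nonneg _) zero_le_one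
      _ = 2 := one_mul _
  have h2 : ‖α⁻¹ ^ (n + 1) *
      (((∑ b ∈ B, ratPlusSymbol f (((2 : ℕ) : ℚ) * tameFraction 2 (m' * ℓ) n a b) : ℚ)) : ℚ_[2])‖ ≤ 2 := by
    rw [norm_mul]
    calc _ ≤ (1 : ℝ) * 2 := mul_le_mul (hαi (n + 1)) hB' (norm_nonneg _) zero_le_one
      _ = 2 := one_mul _
  rw [sub_eq_add_neg]
  refine (Padic.nonarchimedean _ _).trans (max_le h1 ?_)
  rw [norm_neg]
  exact h2

end Measure

/-! ## §4 The Riemann sums at level `m'ℓ`, the pair of lifts, and the congruence with the Euler factors of `m'` only -/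

section Congruence

variable {N : ℕ} [NeZero N] (f : CuspForm (Gamma0 N) 2) {ℓ m' : ℕ} [Fact ℓ.Prime] [NeZero m'] [NeZero (m' * ℓ)]
  {W : WeierstrassCurve ℚ} [W.IsElliptic] [W.IsGloballyMinimal]

omit [NeZero N] [Fact ℓ.Prime] [NeZero m'] in
/-- Splitting a Jacobi-weighted sum mod `m'ℓ`: `Σ_b (b|m'ℓ)·g(b) = Σ_{(b|m'ℓ)=1} g − Σ_{(b|m'ℓ)=−1} g`. [folklore] -/
theorem sum_jacobi_mul_eq (g : ZMod (m' * ℓ) → ℚ_[2]) :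
    ∑ b : ZMod (m' * ℓ), ((J((b.val : ℤ) | m' * ℓ) : ℤ) : ℚ_[2]) * g b =
      ∑ b ∈ Finset.univ.filter (fun b : ZMod (m' * ℓ) ↦ J((b.val : ℤ) | m' * ℓ) = 1), g b -
        ∑ b ∈ Finset.univ.filter (fun b : ZMod (m' * ℓ) ↦ J((b.val : ℤ) | m' * ℓ) = -1), g b := by
  rw [Finset.sum_filter, Finset.sum_filter, ← Finset.sum_sub_distrib]
  refine Finset.sum_congr rfl fun b _ ↦ ?_
  rcases jacobiSym.trichotomy (b.val : ℤ) (m' * ℓ) with h | h | h <;> rw [h] <;> norm_num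

omit [NeZero N] [Fact ℓ.Prime] [NeZero m'] in
/-- Splitting the trivial-character sum mod `m'ℓ`: `Σ_b 𝟙(b)·g(b) = Σ_{(b|m'ℓ)=1} g + Σ_{(b|m'ℓ)=−1} g` (`(b|m'ℓ) ≠ 0` iff `b` is a unit).
[folklore] -/
theorem sum_one_mul_level_eq (g : ZMod (m' * ℓ) → ℚ_[2]) :
    ∑ b : ZMod (m' * ℓ), (1 : DirichletCharacter ℚ_[2] (m' * ℓ)) b * g b =
      ∑ b ∈ Finset.univ.filter (fun b : ZMod (m' * ℓ) ↦ J((b.val : ℤ) | m' * ℓ) = 1), g b +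
        ∑ b ∈ Finset.univ.filter (fun b : ZMod (m' * ℓ) ↦ J((b.val : ℤ) | m' * ℓ) = -1), g b := by
  rw [Finset.sum_filter, Finset.sum_filter, ← Finset.sum_add_distrib]
  refine Finset.sum_congr rfl fun b _ ↦ ?_
  have hunit : IsUnit b ↔ J((b.val : ℤ) | m' * ℓ) ≠ 0 := by
    rw [Ne, jacobiSym.eq_zero_iff_not_coprime, not_not, Int.gcd_natCast_natCast]
    have h := ZMod.isUnit_iff_coprime b.val (m' * ℓ)
    rw [ZMod.natCast_zmod_val] at h
    exact h
  rcases jacobiSym.trichotomy (b.val : ℤ) (m' * ℓ) with h | h | h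
  · have hnu : ¬ IsUnit b := fun hu ↦ (hunit.mp hu) h
    rw [MulChar.map_nonunit _ hnu, h]; norm_num
  · rw [MulChar.one_apply (hunit.mpr (by rw [h]; norm_num)), h]; norm_num
  · rw [MulChar.one_apply (hunit.mpr (by rw [h]; norm_num)), h]; norm_num

omit [NeZero N] [Fact ℓ.Prime] [NeZero m'] [NeZero (m' * ℓ)] [W.IsElliptic] [W.IsGloballyMinimal] in
/-- `γ^s = 5^s` is a unit mod `2ⁿ⁺²`; private helper. [folklore] -/
private theorem isUnit_cyclotomicGenerator_pow' (n s : ℕ) :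
    IsUnit ((cyclotomicGenerator 2 : ZMod (2 ^ (n + 2))) ^ s) := by
  refine IsUnit.pow s ?_
  rw [cyclotomicGenerator_two, ZMod.isUnit_iff_coprime]
  exact Nat.Coprime.pow_right _ (by norm_num)

/-- **`L₂(f,α,χ_{m'ℓ}) ≡ L₂(f,α,𝟙_{m'ℓ}) (mod 2Λ)`, both in `Λ`**, at the tame level `m'ℓ` (`ℓ² ∣ N`, `a_ℓ(f) = 0`, `gcd(m', 2N) = 1`,
`m'ℓ ≡ 1 (mod 4)`), `χ_{m'ℓ} = (·|m'ℓ)` read in `ℚ₂`, for the newform of `E = W` good ordinary at `2` with `E[2]` irreducible.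
[cite: Matsuno2000, Lemma 3.2 (p. 87)] [cite: MazurTateTeitelbaum1986Invent, §I.12–I.13 (pp. 17–19)] -/
theorem exists_iwasawa_pair_map_toZMod_eq_two_level (hord : IsOrdinaryAt W 2) (hf : IsNewformOf W f)
    (hirr : W.HasIrreducibleModPGaloisRep 2) (hℓN : ℓ ^ 2 ∣ N) (haℓ : cuspCoeff f ℓ = 0) (hm'N : m'.Coprime N)
    (hm'2 : m'.Coprime 2) (hM4 : (m' * ℓ) % 4 = 1)
    {χ : MulChar (ZMod (m' * ℓ)) ℤ} (hχ : ∀ a : ZMod (m' * ℓ), χ a = J((a.val : ℤ) | m' * ℓ)) :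
    ∃ G G₁ : IwasawaAlgebra 2,
      iwasawaToPowerSeries 2 G = padicLFunctionTame f (m' * ℓ) (unitRoot W 2 : ℚ_[2])
        ((χ.ringHomComp (Int.castRingHom ℚ)).ringHomComp (Rat.castHom ℚ_[2])) ∧
      iwasawaToPowerSeries 2 G₁ = padicLFunctionTame f (m' * ℓ) (unitRoot W 2 : ℚ_[2])
        (1 : DirichletCharacter ℚ_[2] (m' * ℓ)) ∧
      PowerSeries.map (PadicInt.toZMod (p := 2)) G = PowerSeries.map (PadicInt.toZMod (p := 2)) G₁ := by
  have hℓ : ℓ.Prime := Fact.out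
  have h2N : ¬ 2 ∣ N := not_dvd_level_of_isNewformOf hf hord.1
  have hℓN' : ℓ ∣ N := (dvd_pow_self ℓ two_ne_zero).trans hℓN
  have hℓ2 : ℓ.Coprime 2 := (Nat.coprime_primes hℓ Nat.prime_two).mpr (by rintro rfl; exact h2N hℓN')
  have hM2 : (m' * ℓ).Coprime 2 := Nat.Coprime.mul_left hm'2 hℓ2
  obtain ⟨q, hqF, -, hgood, hndvd⟩ := exists_prime_not_dvd_frobeniusTrace_sub
    not_irreducible_of_frobeniusTrace_congr_holds W 2 hirr
  have hqN : ¬ q ∣ N := not_dvd_level_of_isNewformOf hf hgood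
  have haq : cuspCoeff f q = ((W.frobeniusTrace q : ℤ) : ℂ) := cuspCoeff_eq_frobeniusTrace_of_isNewformOf_holds hf hgood
  have hodd : ¬ (2 : ℤ) ∣ W.frobeniusTrace q - q - 1 := by
    intro h; apply hndvd; push_cast; convert h using 1; ring
  set α : ℚ_[2] := (unitRoot W 2 : ℚ_[2]) with hα
  set χQ : DirichletCharacter ℚ_[2] (m' * ℓ) :=
    (χ.ringHomComp (Int.castRingHom ℚ)).ringHomComp (Rat.castHom ℚ_[2]) with hχQ
  have hχQapp : ∀ b, χQ b = ((J((b.val : ℤ) | m' * ℓ) : ℤ) : ℚ_[2]) := fun b ↦ by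
    rw [hχQ, MulChar.ringHomComp_apply, MulChar.ringHomComp_apply, hχ]; simp
  have hχQeven : χQ.Even := by
    show χQ (-1) = 1
    rw [hχQ, MulChar.ringHomComp_apply, MulChar.ringHomComp_apply, mulChar_jacobi_apply_neg_one hχ hM4]; simp
  have h1even : (1 : DirichletCharacter ℚ_[2] (m' * ℓ)).Even := by
    show (1 : DirichletCharacter ℚ_[2] (m' * ℓ)) (-1) = 1
    rw [MulChar.one_apply (isUnit_one.neg)]
  have h2 : ‖(2 : ℚ_[2])‖ = (2 : ℝ)⁻¹ := by have h := Padic.norm_p (p := 2); simpa using h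
  -- the `b`-sums at the unit classes `γˢ`
  have hbounds : ∀ (n s : ℕ),
      ‖∑ b, χQ b * msdMeasureTame f (m' * ℓ) α (n + 2) ((cyclotomicGenerator 2 : ZMod (2 ^ (n + 2))) ^ s) b‖ ≤ 2 ∧
      ‖∑ b, (1 : DirichletCharacter ℚ_[2] (m' * ℓ)) b *
          msdMeasureTame f (m' * ℓ) α (n + 2) ((cyclotomicGenerator 2 : ZMod (2 ^ (n + 2))) ^ s) b‖ ≤ 2 ∧
      ‖∑ b, χQ b * msdMeasureTame f (m' * ℓ) α (n + 2) ((cyclotomicGenerator 2 : ZMod (2 ^ (n + 2))) ^ s) b -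
          ∑ b, (1 : DirichletCharacter ℚ_[2] (m' * ℓ)) b *
            msdMeasureTame f (m' * ℓ) α (n + 2) ((cyclotomicGenerator 2 : ZMod (2 ^ (n + 2))) ^ s) b‖ ≤ 1 := by
    intro n s
    set μ : ZMod (m' * ℓ) → ℚ_[2] := fun b ↦
      msdMeasureTame f (m' * ℓ) α (n + 2) ((cyclotomicGenerator 2 : ZMod (2 ^ (n + 2))) ^ s) b with hμ
    have hP := norm_sum_filter_msdMeasureTame_level_le_two f hord hf hℓN haℓ hqN haq hodd hm'N hm'2 (Or.inl rfl)
      (n + 2) (isUnit_cyclotomicGenerator_pow' n s) (m' := m')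
    have hM := norm_sum_filter_msdMeasureTame_level_le_two f hord hf hℓN haℓ hqN haq hodd hm'N hm'2 (Or.inr rfl)
      (n + 2) (isUnit_cyclotomicGenerator_pow' n s) (m' := m')
    simp_rw [hχQapp]
    rw [sum_jacobi_mul_eq, sum_one_mul_level_eq]
    refine ⟨?_, (Padic.nonarchimedean _ _).trans (max_le hP hM), ?_⟩
    · rw [sub_eq_add_neg]
      refine (Padic.nonarchimedean _ _).trans (max_le hP ?_)
      rw [norm_neg]; exact hM
    · have he : ∀ P M : ℚ_[2], P - M - (P + M) = -((2 : ℚ_[2]) * M) := fun P M ↦ by ring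
      rw [he, norm_neg, norm_mul, h2]
      calc (2 : ℝ)⁻¹ * _ ≤ (2 : ℝ)⁻¹ * 2 := by gcongr
        _ = 1 := by norm_num
  have hC : ∀ (k n : ℕ) (s : ZMod (2 ^ n)), ‖((s.val.choose k : ℕ) : ℚ_[2])‖ ≤ 1 := fun k n s ↦ by
    have h := Padic.norm_int_le_one (p := 2) ((s.val.choose k : ℕ) : ℤ)
    rwa [Int.cast_natCast] at h
  -- Riemann sums and coefficients
  have hRS : ∀ k n, ‖padicLRiemannSumTame f (m' * ℓ) α χQ k n‖ ≤ 1 ∧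
      ‖padicLRiemannSumTame f (m' * ℓ) α (1 : DirichletCharacter ℚ_[2] (m' * ℓ)) k n‖ ≤ 1 ∧
      ‖padicLRiemannSumTame f (m' * ℓ) α χQ k n -
        padicLRiemannSumTame f (m' * ℓ) α (1 : DirichletCharacter ℚ_[2] (m' * ℓ)) k n‖ ≤ ‖(2 : ℚ_[2])‖ := by
    intro k n
    rw [padicLRiemannSumTame_two_of_even f hM2 α χQ hχQeven, padicLRiemannSumTame_two_of_even f hM2 α 1 h1even,
      ← mul_sub, norm_mul, norm_mul, norm_mul, ← Finset.sum_sub_distrib, h2]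
    refine ⟨?_, ?_, ?_⟩
    · calc (2 : ℝ)⁻¹ * _ ≤ (2 : ℝ)⁻¹ * 2 := by
            gcongr
            refine IsUltrametricDist.norm_sum_le_of_forall_le_of_nonneg zero_le_two fun s _ ↦ ?_
            rw [← Finset.sum_mul, norm_mul]
            exact (mul_le_mul (hbounds n s.val).1 (hC k n s) (norm_nonneg _) zero_le_two).trans (by norm_num)
        _ = 1 := by norm_num
    · calc (2 : ℝ)⁻¹ * _ ≤ (2 : ℝ)⁻¹ * 2 := by
            gcongr
            refine IsUltrametricDist.norm_sum_le_of_forall_le_of_nonneg zero_le_two fun s _ ↦ ?_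
            rw [← Finset.sum_mul, norm_mul]
            exact (mul_le_mul (hbounds n s.val).2.1 (hC k n s) (norm_nonneg _) zero_le_two).trans (by norm_num)
        _ = 1 := by norm_num
    · calc (2 : ℝ)⁻¹ * _ ≤ (2 : ℝ)⁻¹ * 1 := by
            gcongr
            refine IsUltrametricDist.norm_sum_le_of_forall_le_of_nonneg zero_le_one fun s _ ↦ ?_
            rw [← Finset.sum_mul, ← Finset.sum_mul, ← sub_mul, norm_mul]
            exact (mul_le_mul (hbounds n s.val).2.2 (hC k n s) (norm_nonneg _) zero_le_one).trans (by norm_num)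
        _ = (2 : ℝ)⁻¹ := by norm_num
  have hcoef : ∀ k, ‖padicLCoeffTame f (m' * ℓ) α χQ k‖ ≤ 1 ∧
      ‖padicLCoeffTame f (m' * ℓ) α (1 : DirichletCharacter ℚ_[2] (m' * ℓ)) k‖ ≤ 1 ∧
      ‖padicLCoeffTame f (m' * ℓ) α χQ k - padicLCoeffTame f (m' * ℓ) α (1 : DirichletCharacter ℚ_[2] (m' * ℓ)) k‖ ≤
        ‖(2 : ℚ_[2])‖ := by
    intro k
    have hlimχ := tendsto_padicLRiemannSumTame_unitRoot_two hord hf hM2 χQ k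
    have hlim1 := tendsto_padicLRiemannSumTame_unitRoot_two hord hf hM2 (1 : DirichletCharacter ℚ_[2] (m' * ℓ)) k
    exact ⟨le_of_tendsto hlimχ.norm (Eventually.of_forall fun n ↦ (hRS k n).1),
      le_of_tendsto hlim1.norm (Eventually.of_forall fun n ↦ (hRS k n).2.1),
      le_of_tendsto (hlimχ.sub hlim1).norm (Eventually.of_forall fun n ↦ (hRS k n).2.2)⟩
  refine exists_iwasawa_pair_map_toZMod_eq _ _ (fun k ↦ ?_) (fun k ↦ ?_) (fun k ↦ ?_)
  · rw [coeff_padicLFunctionTame]; exact (hcoef k).1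
  · rw [coeff_padicLFunctionTame]; exact (hcoef k).2.1
  · rw [coeff_padicLFunctionTame, coeff_padicLFunctionTame]
    have h := (hcoef k).2.2
    rw [h2] at h; linarith

end Congruence

/-! ## §5 Depletion at level `m'ℓ` and the congruence with the Euler factors of `m'` only -/

section Depletion

variable {N : ℕ} [NeZero N] (f : CuspForm (Gamma0 N) 2) {ℓ m' : ℕ} [Fact ℓ.Prime] [NeZero m'] [NeZero (m' * ℓ)]
  {W : WeierstrassCurve ℚ} [W.IsElliptic] [W.IsGloballyMinimal]

omit [NeZero N] [Fact ℓ.Prime] [NeZero m'] [NeZero (m' * ℓ)] [W.IsElliptic] [W.IsGloballyMinimal] in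
/-- `(1+T)^{c}` is a unit of `Λ`; private helper. [folklore] -/
private theorem isUnit_binomialSeries' {p : ℕ} [Fact p.Prime] (c : ℤ_[p]) :
    IsUnit (PowerSeries.binomialSeries ℤ_[p] c) := by
  refine isUnit_iff_exists_inv.mpr ⟨PowerSeries.binomialSeries ℤ_[p] (-c), ?_⟩
  rw [← PowerSeries.binomialSeries_add, add_neg_cancel, PowerSeries.binomialSeries_zero]

/-- **THE CONGRUENCE AT THE COMPOSITE LEVEL `m'ℓ`: `L₂(f,α,χ_{m'ℓ}) ≡ v·L₂(f,α)·∏_{q∣m'}𝒫_q (mod 2Λ)`** — the both-additive prime `ℓ`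
(`ℓ² ∣ N`, `a_ℓ(f) = 0`) contributes NO Euler factor, the places `S₀` of `m'` (good or multiplicative, `m' = ∏ ℓ_v`, `gcd(m', 2N) = 1`)
contribute Greenberg–Vatsal's `𝒫_v` exactly as in `exists_iwasawa_padicLFunctionTame_congr_two_sqfreeAt`; `χ_{m'ℓ} = (·|m'ℓ)` even
(`m'ℓ ≡ 1 (mod 4)`), `E = W` good ordinary at `2` with `E[2]` irreducible. Depletion: level `m'` by the tree, then the level change at
`ℓ ∣ N` with `U_ℓ f = 0` (`padicLFunctionTame_mul_prime_of_dvd`): `L₂(f,α,𝟙_{m'ℓ}) = −(1+T)^{f_ℓ}·L₂(f,α,𝟙_{m'})`.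
[cite: Matsuno2000, Lemmas 3.2–3.3 and Thm. 3.1 (pp. 86–88)] [cite: GreenbergVatsal2000, §2 Prop. (2.4)] -/
theorem exists_iwasawa_padicLFunctionTame_congr_two_level (hord : IsOrdinaryAt W 2) (hf : IsNewformOf W f)
    (hirr : W.HasIrreducibleModPGaloisRep 2) (hℓN : ℓ ^ 2 ∣ N) (haℓ : cuspCoeff f ℓ = 0) (hm'N : m'.Coprime N)
    (hm'2 : m'.Coprime 2) (hM4 : (m' * ℓ) % 4 = 1)
    (S₀ : Finset (IsDedekindDomain.HeightOneSpectrum (NumberField.RingOfIntegers ℚ)))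
    (hS2 : ∀ v ∈ S₀, Rat.HeightOneSpectrum.natGenerator v ≠ 2)
    (hred : ∀ v ∈ S₀, W.HasGoodReductionAt v ∨ W.HasMultiplicativeReductionAt v)
    (hm' : m' = ∏ v ∈ S₀, Rat.HeightOneSpectrum.natGenerator v)
    {χ : MulChar (ZMod (m' * ℓ)) ℤ} (hχ : ∀ a : ZMod (m' * ℓ), χ a = J((a.val : ℤ) | m' * ℓ)) :
    ∃ (LW G : IwasawaAlgebra 2) (v : (IwasawaAlgebra 2)ˣ),
      iwasawaToPowerSeries 2 LW = padicLFunction f (unitRoot W 2 : ℚ_[2]) ∧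
      iwasawaToPowerSeries 2 G = padicLFunctionTame f (m' * ℓ) (unitRoot W 2 : ℚ_[2])
        ((χ.ringHomComp (Int.castRingHom ℚ)).ringHomComp (Rat.castHom ℚ_[2])) ∧
      PowerSeries.map (PadicInt.toZMod (p := 2)) G =
        PowerSeries.map (PadicInt.toZMod (p := 2)) ((v : IwasawaAlgebra 2) * LW * eulerFactorProduct W 2 S₀) := by
  have hℓ : ℓ.Prime := Fact.out
  have h2N : ¬ 2 ∣ N := not_dvd_level_of_isNewformOf hf hord.1
  have hℓN' : ℓ ∣ N := (dvd_pow_self ℓ two_ne_zero).trans hℓN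
  have hℓ2 : ℓ.Coprime 2 := (Nat.coprime_primes hℓ Nat.prime_two).mpr (by rintro rfl; exact h2N hℓN')
  have hℓm' : ℓ.Coprime m' := (Nat.Coprime.coprime_dvd_right hℓN' hm'N).symm
  obtain ⟨hαeq, hαu, -⟩ := unitRoot_coe_spec (W := W) hord
  -- depletion at the level `m'` (tree) and the level change at `ℓ ∣ N` with `a_ℓ = 0`
  obtain ⟨LW, G₁', u, hLW, hG₁', hc₁⟩ := exists_iwasawa_padicLFunctionTame_one_congr_two_sqfreeAt hord hf S₀ hS2 hred hm'
  obtain ⟨teich, hteich⟩ := exists_teichmuller_frobeniusExponent 2 hℓ2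
  have hlevel := padicLFunctionTame_mul_prime_of_dvd hf.1 hf.coeffField_eq_bot h2N hm'2
    (cuspCoeff_eq_frobeniusTrace_of_isNewformOf_holds hf hord.1) hαeq hαu hℓ hℓN' (aℓ := 0)
    (by rw [haℓ, Int.cast_zero]) hℓ2 hℓm' hteich
  set B : IwasawaAlgebra 2 := PowerSeries.binomialSeries ℤ_[2] (frobeniusExponent 2 (ℓ : ℤ_[2])) with hB
  have hdep : iwasawaToPowerSeries 2 (-B * G₁') =
      padicLFunctionTame f (m' * ℓ) (unitRoot W 2 : ℚ_[2]) (1 : DirichletCharacter ℚ_[2] (m' * ℓ)) := by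
    rw [hlevel, map_mul, map_neg, hB, BurungaleSkinner2023.iwasawaToPowerSeries_binomialSeries, hG₁', Int.cast_zero,
      map_zero, zero_sub]
  -- the character half
  obtain ⟨G, G₁, hG, hG₁, hGG₁⟩ :=
    exists_iwasawa_pair_map_toZMod_eq_two_level f hord hf hirr hℓN haℓ hm'N hm'2 hM4 hχ
  have hG₁eq : G₁ = -B * G₁' := iwasawaToPowerSeries_injective 2 (hG₁.trans hdep.symm)
  have hBu : IsUnit (-B) := (isUnit_binomialSeries' (frobeniusExponent 2 (ℓ : ℤ_[2]))).neg
  refine ⟨LW, G, hBu.unit * u, hLW, hG, ?_⟩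
  rw [hGG₁, hG₁eq, map_mul, hc₁, ← map_mul, Units.val_mul, IsUnit.unit_spec]
  congr 1
  ring

end Depletion





end Summit.BirchSwinnertonDyer.BirchSwinnertonDyer.Theorems.AlignedTransportAtTwoAddTwistCongruenceLevel

end
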